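import Literature.NumberTheory.GaloisRepresentations.PhiGammaModuleRobba
import HarnessLib

/-!
# `HasDrigEtale` is a hypothesis on the `(φ, Γ_F)`-module datum, not a theorem about it

`PhiGammaModuleRobba.HasDrigEtale 𝓣` (file `PhiGammaModuleRobba`) renders, as a PREDICATE on the
enriched datum `𝓣 : PhiGammaModuleRobba p F E` (an abstract `(φ, Γ)`-ring with abstract rules
`D_rig`, `𝓡(δ)` and an abstract predicate `IsEtale`), the theorem that `D_rig` is an equivalence
from `E`-linear representations of `G_F` onto the étale `(φ, Γ_F)`-modules over `𝓡_E(π_F)`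
(Fontaine, Cherbonnier–Colmez, Kedlaya; as printed: [cite: BellaicheChenevier2009, Prop. 2.2.6 (i)
(arXiv:math/0602340 numbering)] for `F = ℚ_p` and Artinian coefficients; in affinoid families
`D_rig` is functorial, fully faithful, exact and commutes with base change
[cite: KedlayaPottharstXiao2014, Thm. 2.2.17] but is "not essentially surjective, even onto the
étale objects" [cite: KedlayaPottharstXiao2014, §1, p. 3 and Remark 2.2.16]).  Like its siblings
`HasLiuFiniteness`, `HasRankOneCohomology`, `HasRankOneClassification`, `HasCFTIdentification`
it is, by the design of that file, "nothing asserted": a route posits `(h : 𝓣.IsKPX d)`.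

This file records, sorry-free, why there is (and can be) no `HasDrigEtale_holds`, i.e. why the
declaration is a parametrised hypothesis and not a closed named fact:

* `PhiGammaModuleRobba.not_hasDrigEtale_update_isEtale_false 𝓣` — for EVERY datum `𝓣`, the
  datum with the same ring, `D_rig`, `𝓡(δ)`, topology, `γ_F` and `homToH1` but `IsEtale := False`
  violates `HasDrigEtale` (clause (1) at the trivial representation of rank `0`): the predicate is
  not a consequence of the other fields;
* `PhiGammaModuleRobba.not_forall_hasDrigEtale_of_nonempty` — hence over any `(p, F, E)` carrying
  a datum, `∀ 𝓣, 𝓣.HasDrigEtale` fails;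
* `PhiGammaModuleRobba.nonempty_of_isAlgClosed p K` — the field axioms of
  `PhiGammaModuleRobba p K (ZMod 2)` are jointly satisfiable for `K` algebraically closed
  (`G_K = 1`, `(ZMod 2)ˣ = 1`, everything trivial: the scratch inhabitant mentioned in the design
  notes of `PhiGammaModuleRobba`, now the witness), so
  `PhiGammaModuleRobba.not_forall_hasDrigEtale`: the universal closure over all `(p, F, E, 𝓣)`
  (at universe `0`, as in `PhiGammaModuleData.nonempty`) is false.

What IS a theorem of the literature is that the GENUINE datum (Robba ring `𝓡_E(π_F)`, Berger's
`D_rig^†`, Kedlaya's "pure of slope `0`") satisfies `HasDrigEtale`; stating that needs those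
constructions (cf. the named fact `PhiGammaModuleData.nonempty` of `Trianguline.lean`), which
neither Mathlib nor this tree has.

## References

* K. S. Kedlaya, J. Pottharst, L. Xiao, *Cohomology of arithmetic families of `(φ, Γ)`-modules*,
  JAMS 27 (2014), arXiv:1203.5718 — §1 p. 3, Remark 2.2.16, Thm. 2.2.17. [KedlayaPottharstXiao2014]
* J. Bellaïche, G. Chenevier, *Families of Galois representations and Selmer groups*, Astérisque
  324 (2009), arXiv:math/0602340 — §2.2.5, Prop. 2.2.6. [BellaicheChenevier2009]
-/

noncomputable section

namespace Literature.NumberTheory.GaloisRepresentations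

open Field

universe u v w

namespace PhiGammaModuleRobba

section Update

variable {p : ℕ} [Fact p.Prime] {F : Type u} [Field F] [TopologicalSpace F]
  {E : Type v} [Field E] [TopologicalSpace E] [IsTopologicalRing E]

/-- **`HasDrigEtale` is not a consequence of the other fields of the datum**: in ANY datum `𝓣`,
replacing the predicate `IsEtale` by the constantly false one (same `(φ, Γ)`-ring, `D_rig`, `𝓡(δ)`,
topology, `γ_F`, `homToH1`) violates it (clause (1), "`D_rig ρ` is étale", at the trivial
representation of rank `0`). [folklore] -/
theorem not_hasDrigEtale_update_isEtale_false (𝓣 : PhiGammaModuleRobba.{u, v, w} p F E) :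
    ¬ ({ 𝓣 with IsEtale := fun _ => False } : PhiGammaModuleRobba.{u, v, w} p F E).HasDrigEtale :=
  fun h => (h.1 0 1).2

/-- Over any `(p, F, E)` carrying one datum, the closure `∀ 𝓣, 𝓣.HasDrigEtale` is false.
[folklore] -/
theorem not_forall_hasDrigEtale_of_nonempty (h𝓣 : Nonempty (PhiGammaModuleRobba.{u, v, w} p F E)) :
    ¬ ∀ 𝓣 : PhiGammaModuleRobba.{u, v, w} p F E, 𝓣.HasDrigEtale :=
  fun h => h𝓣.elim fun 𝓣 => not_hasDrigEtale_update_isEtale_false 𝓣 (h _)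

end Update

/-! ### The datum type is inhabited (degenerate datum over an algebraically closed field) -/

section Degenerate

variable (p : ℕ) [Fact p.Prime] (K : Type u) [Field K] [TopologicalSpace K] [IsAlgClosed K]

omit [TopologicalSpace K] in
/-- `G_K = 1` for `K` algebraically closed: every element of `K̄` comes from `K`
(`IsAlgClosed.algebraMap_bijective_of_isIntegral`), so a `K`-automorphism is the identity.
(Also `subsingleton_absoluteGaloisGroup_of_isAlgClosed` in
`NumberTheory/EllipticCurves/SelmerGaloisAction.lean`; re-proved to spare the import.) [folklore] -/
private theorem subsingleton_absoluteGaloisGroup : Subsingleton (absoluteGaloisGroup K) := by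
  refine ⟨fun g h => AlgEquiv.ext fun x => ?_⟩
  obtain ⟨e, rfl⟩ :=
    (IsAlgClosed.algebraMap_bijective_of_isIntegral (k := K) (K := AlgebraicClosure K)).2 x
  rw [AlgEquiv.commutes, AlgEquiv.commutes]

/-- **The field axioms of `PhiGammaModuleRobba p K (ZMod 2)` are jointly satisfiable** for `K`
algebraically closed, by a DEGENERATE datum: the trivial `(φ, Γ)`-ring on `ZMod 2` itself
(`G_K` acting trivially, `φ = id`), `D_rig ρ` and `𝓡(δ)` all trivial (the axioms hold because
`G_K = 1`, so every `ρ` is trivial, and `(ZMod 2)ˣ = 1`, so every `δ` is trivial), the discrete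
topology, `γ_K := 1` (dense since `G_K = 1`), `homToH1 := 0`, `IsEtale := False`.  A junk
inhabitant (the scratch check mentioned in the design notes of `PhiGammaModuleRobba`), recorded
only as the witness of `not_forall_hasDrigEtale`. [folklore] -/
theorem nonempty_of_isAlgClosed : Nonempty (PhiGammaModuleRobba.{u, 0, 0} p K (ZMod 2)) := by
  haveI := subsingleton_absoluteGaloisGroup K
  -- the trivial action of `G_K` on `ZMod 2` by ring endomorphisms
  let act : MulSemiringAction (absoluteGaloisGroup K) (ZMod 2) :=
    { smul := fun _ r => r
      one_smul := fun _ => rfl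
      mul_smul := fun _ _ _ => rfl
      smul_zero := fun _ => rfl
      smul_add := fun _ _ _ => rfl
      smul_one := fun _ => rfl
      smul_mul := fun _ _ _ => rfl }
  -- the trivial `(φ, Γ)`-ring on `ZMod 2`
  let 𝓡 : PhiGammaRing.{u, 0, 0} (absoluteGaloisGroup K) (ZMod 2) :=
    { R := ZMod 2
      action := act
      smulComm := @SMulCommClass.mk _ _ _ act.toSMul _ fun _ _ _ => rfl
      frob := AlgHom.id (ZMod 2) (ZMod 2)
      frob_smul := fun _ _ => rfl }
  -- the degenerate `PhiGammaModuleData`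
  let 𝔇 : PhiGammaModuleData.{u, 0, 0} p K (ZMod 2) :=
    { ring := 𝓡
      smul_eq_self := fun _ _ _ => rfl
      Drig := fun {n} _ => FramedPhiGammaModule.trivial 𝓡 n
      Drig_matGamma_eq_one := fun _ _ _ => rfl
      Drig_conj := fun _ _ => FramedPhiGammaModule.IsIso.refl _
      Drig_injective := fun ρ ρ' _ =>
        ⟨1, ContinuousMonoidHom.ext fun σ => by rw [Subsingleton.elim σ 1, map_one, map_one]⟩
      Drig_one := fun _ => FramedPhiGammaModule.IsIso.refl _
      charMod := fun _ => FramedPhiGammaModule.trivial 𝓡 1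
      charMod_matGamma_eq_one := fun _ _ _ => rfl
      charMod_one := FramedPhiGammaModule.IsIso.refl _
      charMod_injective := fun _ _ _ => ContinuousMonoidHom.ext fun _ => Subsingleton.elim _ _
      Drig_rank_one := fun _ => ⟨1, FramedPhiGammaModule.IsIso.refl _⟩ }
  exact
   ⟨{ toPhiGammaModuleData := 𝔇
      topR := inferInstanceAs (TopologicalSpace (ZMod 2))
      topRingR := inferInstanceAs (IsTopologicalRing (ZMod 2))
      continuous_frob := continuous_of_discreteTopology (α := ZMod 2)
      continuous_act := fun _ => continuous_of_discreteTopology (α := ZMod 2)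
      continuous_orbit := fun r =>
        show Continuous fun _ : absoluteGaloisGroup K => r from continuous_const
      gen := 1
      dense_gen := fun x => subset_closure <| by
        rw [SetLike.mem_coe, Subsingleton.elim x 1]
        exact one_mem _
      homToH1 := 0
      IsEtale := fun _ => False }⟩

end Degenerate

/-- **The universal closure of `HasDrigEtale` is false** (witness: a degenerate datum over
`F = ℂ`, `E = ZMod 2`, `p = 2`; universe `0` as in `PhiGammaModuleData.nonempty`).  Hence
`HasDrigEtale` is a hypothesis a route assumes about "the" `(φ, Γ_F)`-module theory — a
parametrised predicate with no `_holds` — and not a named fact. [folklore] -/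
theorem not_forall_hasDrigEtale :
    ¬ ∀ (p : ℕ) [Fact p.Prime] (F : Type) [Field F] [TopologicalSpace F] (E : Type) [Field E]
        [TopologicalSpace E] [IsTopologicalRing E] (𝓣 : PhiGammaModuleRobba.{0, 0, 0} p F E),
        𝓣.HasDrigEtale :=
  fun h => not_forall_hasDrigEtale_of_nonempty (nonempty_of_isAlgClosed 2 ℂ) (h 2 ℂ (ZMod 2))

end PhiGammaModuleRobba

end Literature.NumberTheory.GaloisRepresentations

end
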